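import Literature.AlgebraicGeometry.Motives.HodgeLieWeightOneRankFourCorner
import Literature.RepresentationTheory.GeneralLinear.QuadraticCommutantRank
import HarnessLib

/-!
# Weight-one Hodge structures with Hodge group of rank four, not of CM type. G: summary — the central splitting
# `V = ker φ ⊕ range φ` of a rank-four Hodge structure, read on `End_Hdg(V)`

Family `hodge`, layer `Literature/AlgebraicGeometry/Motives`; THEOREMS ONLY (no definition, no named fact; D-0026).
Seventh and last abstract file of the lane MT-RANK-FIVE of the cell `pub-hodgecm2` (setting as in
`Motives/HodgeLieWeightOneRankFourBlocks`: polarizable weight-one `H` with `dim_ℚ Lie Hg = 4` and `Lie Hg ⊄ End_Hdg(V)`).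

* `exists_rat_central_of_finrank_hodgeLie_eq_four` — **the structure theorem, in terms of `End_Hdg(V)` alone**: there
  are a Hodge endomorphism `φ ≠ 0` lying in `Lie Hg` and in the centre of `End_Hdg(V)`, and `q ∈ ℚ_{<0}`, with
  `φ³ = qφ`, `ker φ ≠ 0`; the corner `A' = {a ∈ End_Hdg | aφ = 0}` has `4 · dim_ℚ A' = (dim_ℚ ker φ)²` and centre
  `ℚ · (1 − q⁻¹φ²)`; and every rational endomorphism commuting with `φ` and supported on `range φ` (`aφ² = qa`) is a
  Hodge endomorphism (on `range φ_ℂ` the Hodge operator `2P − 1` equals `μ⁻¹φ_ℂ`, `μ² = q`); consequently the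
  opposite corner `A'' = {a ∈ End_Hdg | aφ² = qa}` is the full commutant of `φ` on `range φ`, of dimension
  `(dim_ℚ range φ)² / 2` (`GeneralLinear.two_mul_finrank_commutant_range`).  Everything else (`P, E, F`, the graded
  basis) is now internal.

Geometric reading (`Summits/HodgeConjecture/CorCM/MumfordTateRankFive*`): for a complex abelian variety `X` not of CM
type with `dim Hg(H¹X) = 4`, `φ` is `z^*` for a central `z ∈ End⁰(X)` with `z³ = qz`; `ker φ = H¹` of an isotypic
non-CM factor `B^a` with `dim End⁰ = (dim)²`, `range φ = H¹` of `E^b` with `E` an elliptic curve with complex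
multiplication by `ℚ(√q)` (Moonen–Zarhin 1999 §2).

## References

* [MoonenZarhin1999LowDim] B. Moonen, Yu. Zarhin, *Hodge classes on abelian varieties of low dimension*, Math. Ann. 315
  (1999), §2.
* [Deligne1982HodgeCycles] P. Deligne, *Hodge cycles on abelian varieties*, LNM 900 (1982), I §3, Ex. 3.7.
* [Zarhin1983HodgeGroupsK3] Yu. G. Zarhin, *Hodge groups of K3 surfaces*, J. reine angew. Math. 341 (1983), §2.
-/

noncomputable section

open scoped TensorProduct

namespace Literature.AlgebraicGeometry.Motives

universe u

namespace HodgeStructure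

open ProjectorBlocks Literature.RepresentationTheory.GeneralLinear

variable {V : Type u} [AddCommGroup V] [Module ℚ V] [Module.Finite ℚ V] [HodgeTensorFacts.{u, u}] {n : ℤ}

/-- **Structure of a polarizable weight-one Hodge structure with `dim Lie Hg = 4` which is not of CM type, read on
`End_Hdg(V)`.**  There are `φ ∈ Lie Hg ∩ End_Hdg(V)`, `φ ≠ 0`, commuting with `End_Hdg(V)`, and `q ∈ ℚ`, `q < 0`, with:
`φ³ = qφ`; `ker φ ≠ 0`; `4 · dim_ℚ {a ∈ End_Hdg | aφ = 0} = (dim_ℚ ker φ)²`; every `z ∈ End_Hdg` with `zφ = 0` commuting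
with all such `a` is a rational multiple of `1 − q⁻¹φ²`; every rational `a` with `aφ = φa` and `aφ² = qa` is a Hodge
endomorphism, and `2 · dim_ℚ {a ∈ End_Hdg | aφ² = qa} = (dim_ℚ range φ)²`.  (Assembly of `exists_rat_central_cube` and `corner_ker_of_rat_central`; the last clause: `a_ℂ` kills
`ker φ_ℂ`, preserves `range φ_ℂ`, and there `2P − 1 = μ⁻¹ φ_ℂ` commutes with `a_ℂ`, so `a_ℂ` commutes with `P`.)
Classically `Hg⁰ = SL₂ · U(1)`, `V = V' ⊕ V''` with `Hg` acting on `V' = ker φ` through `SL₂` and on `V'' = range φ`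
through `U(1) ⊂ ℚ(√q)^×`. [cite: MoonenZarhin1999LowDim, §2] [cite: Deligne1982HodgeCycles, I §3 and Ex. 3.7] -/
theorem exists_rat_central_of_finrank_hodgeLie_eq_four (H : HodgeStructure V n) (ψ : H.Polarization) (hn : n = 1)
    (hH : H.IsEffective) (hne : ¬ H.hodgeLie ≤ Subalgebra.toSubmodule H.endAlg)
    (h4 : Module.finrank ℚ H.hodgeLie = 4) :
    ∃ (φ : Module.End ℚ V) (q : ℚ), φ ∈ H.hodgeLie ∧ φ ≠ 0 ∧ φ ∈ H.endAlg ∧ (∀ a ∈ H.endAlg, φ * a = a * φ) ∧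
      q < 0 ∧ φ * φ * φ = q • φ ∧ LinearMap.ker φ ≠ ⊥ ∧
      4 * Module.finrank ℚ ↥(Subalgebra.toSubmodule H.endAlg ⊓ LinearMap.ker (LinearMap.mulRight ℚ φ)) =
        Module.finrank ℚ (LinearMap.ker φ) ^ 2 ∧
      (∀ z ∈ H.endAlg, z * φ = 0 → (∀ a ∈ H.endAlg, a * φ = 0 → z * a = a * z) →
        ∃ c : ℚ, z = c • (1 - q⁻¹ • (φ * φ))) ∧
      (∀ a : Module.End ℚ V, a * φ = φ * a → a * (φ * φ) = q • a → a ∈ H.endAlg) ∧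
      2 * Module.finrank ℚ ↥(Subalgebra.toSubmodule H.endAlg ⊓
          LinearMap.ker (LinearMap.mulRight ℚ (φ * φ) - q • LinearMap.id)) =
        Module.finrank ℚ (LinearMap.range φ) ^ 2 := by
  classical
  obtain ⟨X, hX, hXE⟩ := SetLike.not_le_iff_exists.1 hne
  rw [Subalgebra.mem_toSubmodule] at hXE
  obtain ⟨S, deg, e, hF, hFc⟩ := exists_basis_F_eq_span H
  haveI : Fintype S := FiniteDimensional.fintypeBasisIndex e
  have hdeg : ∀ σ, deg σ = 0 ∨ deg σ = 1 := fun σ => by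
    have h := hH.deg_mem_Icc_of_graded e hF hFc σ
    omega
  subst hn
  obtain ⟨φ, hφh, hφ0, hφA, hφcA, -, hspan, hΦE0, hΦF0, α, β, q, hβ, hα, hq, hqμ, hq3, -, hEFc, hFEc, hΦ2, -, -⟩ :=
    exists_rat_central_cube H ψ rfl e hF hFc hdeg hX hXE h4
  obtain ⟨hker, hdim, hcen⟩ := corner_ker_of_rat_central H rfl e hF hFc hdeg hX hXE hφA hφcA hspan hΦE0 hΦF0 hα hq.ne hq3
    hEFc hFEc
  -- the commutant of `φ` on `range φ` is Hodge
  have hC3 : ∀ a : Module.End ℚ V, a * φ = φ * a → a * (φ * φ) = q • a → a ∈ H.endAlg := by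
    intro a haφ haq
    set P := gradingEnd e deg with hP
    set Φ := φ.baseChange ℂ with hΦdef
    set A := a.baseChange ℂ with hAdef
    have hPP : P * P = P := gradingEnd_mul_gradingEnd_of_deg e hdeg
    have hΘ' : (2 : ℂ) • P - 1 ∈ H.hodgeLieC := by
      simpa only [Int.cast_one, one_smul] using two_smul_gradingEnd_sub_mem_hodgeLieC H e hF hFc
    have hΦΘ : Φ * ((2 : ℂ) • P - 1) = ((2 : ℂ) • P - 1) * Φ :=
      (commute_baseChange_of_mem_hodgeLieC H hΘ' ⟨φ, hφA⟩).symm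
    have hq0 : (q : ℂ) ≠ 0 := by exact_mod_cast hq.ne
    have hμ0 : -(α / β) ≠ 0 := neg_ne_zero.2 (div_ne_zero hα hβ)
    have hAΦ : A * Φ = Φ * A := by rw [hAdef, hΦdef, ← LinearMap.baseChange_mul, haφ, LinearMap.baseChange_mul]
    have hAq : A * (Φ * Φ) = (q : ℂ) • A := by
      rw [hAdef, hΦdef, ← LinearMap.baseChange_mul, ← LinearMap.baseChange_mul, haq, baseChange_ratCast_smul]
    -- `A` kills `ker Φ`
    have hAker : ∀ y, Φ y = 0 → A y = 0 := by
      intro y hy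
      have h : (q : ℂ) • A y = 0 := by
        rw [← LinearMap.smul_apply, ← hAq, Module.End.mul_apply, Module.End.mul_apply, hy, map_zero, map_zero]
      exact (smul_eq_zero.1 h).resolve_left hq0
    -- on `range Φ`: `(2P - 1) (Φ s) = μ⁻¹ Φ (Φ s)`
    have hΘr : ∀ s, ((2 : ℂ) • P - 1) (Φ s) = (-(α / β))⁻¹ • Φ (Φ s) := by
      intro s
      have h : (Φ * Φ) s = (-(α / β)) • (((2 : ℂ) • P - 1) (Φ s)) := by
        rw [hΦ2, hΦΘ, LinearMap.smul_apply, Module.End.mul_apply]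
      rw [Module.End.mul_apply] at h
      rw [h, smul_smul, inv_mul_cancel₀ hμ0, one_smul]
    -- `A` commutes with `2P - 1`
    have hdec : ∀ x : ℂ ⊗[ℚ] V, x = (x - (q : ℂ)⁻¹ • Φ (Φ x)) + (q : ℂ)⁻¹ • Φ (Φ x) := fun x => by rw [sub_add_cancel]
    have hkerpart : ∀ x : ℂ ⊗[ℚ] V, Φ (x - (q : ℂ)⁻¹ • Φ (Φ x)) = 0 := by
      intro x
      have hΦ3 : Φ * Φ * Φ = (q : ℂ) • Φ := by
        rw [hΦdef, ← LinearMap.baseChange_mul, ← LinearMap.baseChange_mul, hq3, baseChange_ratCast_smul]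
      rw [map_sub, map_smul, ← Module.End.mul_apply, ← Module.End.mul_apply, hΦ3, LinearMap.smul_apply, smul_smul,
        inv_mul_cancel₀ hq0, one_smul, sub_self]
    have hAΘ : A * ((2 : ℂ) • P - 1) = ((2 : ℂ) • P - 1) * A := by
      refine LinearMap.ext fun x => ?_
      rw [Module.End.mul_apply, Module.End.mul_apply]
      conv_lhs => rw [hdec x]
      conv_rhs => rw [hdec x]
      rw [map_add, map_add, map_add, map_add]
      congr 1
      · -- the `ker Φ` part: both sides vanish
        have h1 : A (x - (q : ℂ)⁻¹ • Φ (Φ x)) = 0 := hAker _ (hkerpart x)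
        have h2 : Φ (((2 : ℂ) • P - 1) (x - (q : ℂ)⁻¹ • Φ (Φ x))) = 0 := by
          rw [← Module.End.mul_apply, hΦΘ, Module.End.mul_apply, hkerpart, map_zero]
        rw [h1, map_zero, hAker _ h2]
      · -- the `range Φ` part
        rw [map_smul, map_smul, map_smul, map_smul, hΘr, map_smul, ← Module.End.mul_apply A Φ, hAΦ, Module.End.mul_apply,
          ← Module.End.mul_apply A Φ, hAΦ, Module.End.mul_apply, hΘr]
    have hAP : A * P = P * A := by
      rw [mul_sub A _ 1, sub_mul _ 1 A, mul_one, one_mul, mul_smul_comm, smul_mul_assoc, sub_left_inj] at hAΘ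
      exact smul_right_injective _ (two_ne_zero' ℂ) hAΘ
    exact mem_endAlg_of_projE_eq_zero H e hF hdeg (blocks_D hPP hAP).1 (blocks_D hPP hAP).2

  refine ⟨φ, q, hφh, hφ0, hφA, hφcA, hq, hq3, hker, hdim, hcen, hC3, ?_⟩
  exact two_mul_finrank_commutant_range φ hq hq3 fun a => by
    simp only [Submodule.mem_inf, Subalgebra.mem_toSubmodule, LinearMap.mem_ker, LinearMap.sub_apply,
      LinearMap.mulRight_apply, LinearMap.smul_apply, LinearMap.id_coe, id_eq, sub_eq_zero]
    exact ⟨fun h => ⟨(hφcA a h.1).symm, h.2⟩, fun h => ⟨hC3 a h.1 h.2, h.2⟩⟩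

end HodgeStructure

end Literature.AlgebraicGeometry.Motives

end
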